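import Summits.ResolutionOfSingularities.ResolutionOfSingularities.Theorems.FrobeniusLadderFInjectiveMacaulayficationFDSpecimen
import Summits.ResolutionOfSingularities.ResolutionOfSingularities.Theorems.FrobeniusLadderFInjectiveMacaulayficationPointFloorNotFullOfFedder
import Summits.ResolutionOfSingularities.ResolutionOfSingularities.Theorems.FrobeniusLadderFInjectiveMacaulayficationLx6c3PointFloor
import HarnessLib

/-!
# (W-TD) BED D (D-0) `z⁴ + x⁵z + x⁶ + y³ + u³ + t⁷` (char 2): THE POINT FLOOR IS LEGAL (admissible, CM) ∧ NOT FULL, for EVERY blowing up — input half of row #8 `f4pos_rowD_twoStorey`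
# (crux `FInjectiveMacaulayfication` stmt-ResolutionOfSingularities-15315, chain w45a; res-L1-w45a-plan-1 RULING R21.15 (2) «PROGRAMME (W-TD) ON BED D, (D-0) INPUT SIDE — stub-3»; BED D = this seat's candidate, plane-rigid per res-L1-w45a-tri-2 g17; = ONE
# application each of ✓p651649 `PointFloorLegalOfIsolated.pointFloor_input_legal` and ✓p652060 `PointFloorNotFullOfFedder.pointFloor_not_full` to `FDSpecimen`;
# seat res-L1-w45a-stub-3 g11; twin of `P3d4z4557PointFloor`)

[OURS · L1 W4.5a] Support file (`--supports stmt-ResolutionOfSingularities-15315 --as helper`); def-free; §1–§2 UNCONDITIONAL; §3 instantiates the CANDIDATE statements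
`IntrinsicTower.Recipes.TowerTerminates c` / `LocalFullificationFibreAdmGe4Split.LocalFInjectivizationFibreAdmGe4` taken as HYPOTHESES at `(d, p) = (4, 2)`. Replaces the
role of NO printed item; NOT a statement of the manuscript; AI-written (AI review is weaker than expert review).

WHAT. `X = Spec A₀`, `A₀ = k[x,y,u,t,z]/(z⁴ + x⁵z + x⁶ + y³ + u³ + t⁷)` (`X 0..X 4 = x,y,u,t,z`), `char k = 2` (any field), `v` = the origin (multiplicity 3),
`𝔪 = 𝔪_v`, `I := 𝔪̃|_{Spec 𝒪_{X,v}}` — the POINT FLOOR. Rees charts `k[X]/(gᵢ)`, `θᵢ f = Xᵢ³·gᵢ`: `g_x = xz⁴ + x³z + x³ + y³ + u³ + x⁴t⁷`,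
`g_y = yz⁴ + x⁵y³z + x⁶y³ + 1 + u³ + y⁴t⁷`, `g_u = uz⁴ + x⁵u³z + x⁶u³ + y³ + 1 + u⁴t⁷`, `g_t = tz⁴ + x⁵t³z + x⁶t³ + y³ + u³ + t⁴`, `g_z = z + x⁵z³ + x⁶z³ + y³ + u³ + t⁷z⁴`.
* §1 `theta`, `g_not_mem_span_X`, `constantCoeff_g_zero`, ★ `g_zero_mem_bracket` (the x-chart origin is NOT F-pure: `g_x ∈ 𝔫^{[2]}` termwise);
* §2 ★★ `pointFloor_fD_input_legal`, ★★ `pointFloor_fD_not_full`, `not_recipeTowerFull_zero`;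
* §3 BY NAME at `(d, p) = (4, 2)`: `recipeTowerFull_of_towerTerminates`, `fHalf_at_pointFloor`.
The CURE half is OPEN: the Σ_f-refining toric strict transform keeps two NON-F-pure points over the origin (evidence, this seat's `fD_check.py` / `fD_fedder.py`).
[folklore assembly; cite: GortzWedhorn2020, Prop. 13.91 (2), (13.19)] [cite: StacksProject, Tag 0804; Tag 02OS; Tag 01J7] [cite: Temkin2008, §2.1] [cite: Fedder1983, Prop. 1.7]
[cite: Kollar2007, §2.5 (strict transforms under point blow-ups)]
-/

-- single-problem summit: the doubled namespace component is forced
set_option linter.dupNamespace false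

noncomputable section

namespace Summit.ResolutionOfSingularities.ResolutionOfSingularities.Theorems.FInjectiveMacaulayfication.FDPointFloor

open CategoryTheory CategoryTheory.Limits AlgebraicGeometry TopologicalSpace IsLocalRing MvPolynomial
open Literature.AlgebraicGeometry.Resolution
open Summit.ResolutionOfSingularities.ResolutionOfSingularities.Theorems.FInjectiveMacaulayfication
open SliceableCentre GermOfGlobalBlowup

variable (k : Type) [Field k]

/-! ## §1 The strict transforms and the Fedder certificate of the `y`-chart -/

/-- ★ **The chart identities** `θᵢ f = Xᵢ³ · gᵢ` for the point blow-up substitutions `θᵢ : Xⱼ ↦ XⱼXᵢ (j ≠ i), Xᵢ ↦ Xᵢ`. [folklore] -/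
theorem theta (f : MvPolynomial (Fin 5) k) (hf : f = X 4 ^ 4 + X 0 ^ 5 * X 4 + X 0 ^ 6 + X 1 ^ 3 + X 2 ^ 3 + X 3 ^ 7) :
    ∀ i : Fin 5, aeval (fun j : Fin 5 => if j = i then (X i : MvPolynomial (Fin 5) k) else X j * X i) f =
      X i ^ ((fun _ : Fin 5 => 3) i) * (![X 0 * X 4 ^ 4 + X 0 ^ 3 * X 4 + X 0 ^ 3 + X 1 ^ 3 + X 2 ^ 3 + X 0 ^ 4 * X 3 ^ 7,
        X 1 * X 4 ^ 4 + X 0 ^ 5 * X 1 ^ 3 * X 4 + X 0 ^ 6 * X 1 ^ 3 + 1 + X 2 ^ 3 + X 1 ^ 4 * X 3 ^ 7,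
        X 2 * X 4 ^ 4 + X 0 ^ 5 * X 2 ^ 3 * X 4 + X 0 ^ 6 * X 2 ^ 3 + X 1 ^ 3 + 1 + X 2 ^ 4 * X 3 ^ 7,
        X 3 * X 4 ^ 4 + X 0 ^ 5 * X 3 ^ 3 * X 4 + X 0 ^ 6 * X 3 ^ 3 + X 1 ^ 3 + X 2 ^ 3 + X 3 ^ 4,
        X 4 + X 0 ^ 5 * X 4 ^ 3 + X 0 ^ 6 * X 4 ^ 3 + X 1 ^ 3 + X 2 ^ 3 + X 3 ^ 7 * X 4 ^ 4] : Fin 5 → MvPolynomial (Fin 5) k) i := by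
  intro i
  subst hf
  fin_cases i <;> simp <;> ring

/-- `gᵢ ∉ (Xᵢ)` for every `i`: evaluate at `e_z` (`gᵢ = 1` there, `i ≤ 3`) resp. at `0` (`g_z(0) = 1`). [folklore] -/
theorem g_not_mem_span_X :
    ∀ i : Fin 5, (![X 0 * X 4 ^ 4 + X 0 ^ 3 * X 4 + X 0 ^ 3 + X 1 ^ 3 + X 2 ^ 3 + X 0 ^ 4 * X 3 ^ 7,
        X 1 * X 4 ^ 4 + X 0 ^ 5 * X 1 ^ 3 * X 4 + X 0 ^ 6 * X 1 ^ 3 + 1 + X 2 ^ 3 + X 1 ^ 4 * X 3 ^ 7,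
        X 2 * X 4 ^ 4 + X 0 ^ 5 * X 2 ^ 3 * X 4 + X 0 ^ 6 * X 2 ^ 3 + X 1 ^ 3 + 1 + X 2 ^ 4 * X 3 ^ 7,
        X 3 * X 4 ^ 4 + X 0 ^ 5 * X 3 ^ 3 * X 4 + X 0 ^ 6 * X 3 ^ 3 + X 1 ^ 3 + X 2 ^ 3 + X 3 ^ 4,
        X 4 + X 0 ^ 5 * X 4 ^ 3 + X 0 ^ 6 * X 4 ^ 3 + X 1 ^ 3 + X 2 ^ 3 + X 3 ^ 7 * X 4 ^ 4] : Fin 5 → MvPolynomial (Fin 5) k) i ∉ Ideal.span {(X i : MvPolynomial (Fin 5) k)} := by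
  intro i h
  rw [Ideal.mem_span_singleton] at h
  obtain ⟨c, hc⟩ := h
  fin_cases i
  · have := congrArg (MvPolynomial.eval (Pi.single 1 1 : Fin 5 → k)) hc; simp at this
  · have := congrArg (MvPolynomial.eval (0 : Fin 5 → k)) hc; simp at this
  · have := congrArg (MvPolynomial.eval (0 : Fin 5 → k)) hc; simp at this
  · have := congrArg (MvPolynomial.eval (Pi.single 1 1 : Fin 5 → k)) hc; simp at this
  · have := congrArg (MvPolynomial.eval (Pi.single 1 1 : Fin 5 → k)) hc; simp at this

/-- `g_y` has no constant term. [plumbing] -/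
theorem constantCoeff_g_zero : constantCoeff ((![X 0 * X 4 ^ 4 + X 0 ^ 3 * X 4 + X 0 ^ 3 + X 1 ^ 3 + X 2 ^ 3 + X 0 ^ 4 * X 3 ^ 7,
        X 1 * X 4 ^ 4 + X 0 ^ 5 * X 1 ^ 3 * X 4 + X 0 ^ 6 * X 1 ^ 3 + 1 + X 2 ^ 3 + X 1 ^ 4 * X 3 ^ 7,
        X 2 * X 4 ^ 4 + X 0 ^ 5 * X 2 ^ 3 * X 4 + X 0 ^ 6 * X 2 ^ 3 + X 1 ^ 3 + 1 + X 2 ^ 4 * X 3 ^ 7,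
        X 3 * X 4 ^ 4 + X 0 ^ 5 * X 3 ^ 3 * X 4 + X 0 ^ 6 * X 3 ^ 3 + X 1 ^ 3 + X 2 ^ 3 + X 3 ^ 4,
        X 4 + X 0 ^ 5 * X 4 ^ 3 + X 0 ^ 6 * X 4 ^ 3 + X 1 ^ 3 + X 2 ^ 3 + X 3 ^ 7 * X 4 ^ 4] : Fin 5 → MvPolynomial (Fin 5) k) 0) = 0 := by
  simp [constantCoeff_X]

/-- ★ **The Fedder certificate of the `x`-chart**: `g_x = xz⁴ + x³z + x³ + y³ + u³ + x⁴t⁷ ∈ 𝔫^{[2]} = (X0², …, X4²)` termwise (`p − 1 = 1`).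
[certificate; cite: Fedder1983, Prop. 1.7] -/
theorem g_zero_mem_bracket :
    ((![X 0 * X 4 ^ 4 + X 0 ^ 3 * X 4 + X 0 ^ 3 + X 1 ^ 3 + X 2 ^ 3 + X 0 ^ 4 * X 3 ^ 7,
        X 1 * X 4 ^ 4 + X 0 ^ 5 * X 1 ^ 3 * X 4 + X 0 ^ 6 * X 1 ^ 3 + 1 + X 2 ^ 3 + X 1 ^ 4 * X 3 ^ 7,
        X 2 * X 4 ^ 4 + X 0 ^ 5 * X 2 ^ 3 * X 4 + X 0 ^ 6 * X 2 ^ 3 + X 1 ^ 3 + 1 + X 2 ^ 4 * X 3 ^ 7,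
        X 3 * X 4 ^ 4 + X 0 ^ 5 * X 3 ^ 3 * X 4 + X 0 ^ 6 * X 3 ^ 3 + X 1 ^ 3 + X 2 ^ 3 + X 3 ^ 4,
        X 4 + X 0 ^ 5 * X 4 ^ 3 + X 0 ^ 6 * X 4 ^ 3 + X 1 ^ 3 + X 2 ^ 3 + X 3 ^ 7 * X 4 ^ 4] : Fin 5 → MvPolynomial (Fin 5) k) 0) ^ (2 - 1) ∈
      Ideal.span (Set.range fun i : Fin 5 => (X i : MvPolynomial (Fin 5) k) ^ 2) := by
  have hsq : ∀ j : Fin 5, (X j : MvPolynomial (Fin 5) k) ^ 2 ∈ Ideal.span (Set.range fun i : Fin 5 => (X i : MvPolynomial (Fin 5) k) ^ 2) :=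
    fun j => Ideal.subset_span ⟨j, rfl⟩
  rw [show (2 - 1 : ℕ) = 1 from rfl, pow_one]
  change (X 0 * X 4 ^ 4 + X 0 ^ 3 * X 4 + X 0 ^ 3 + X 1 ^ 3 + X 2 ^ 3 + X 0 ^ 4 * X 3 ^ 7 : MvPolynomial (Fin 5) k) ∈ _
  refine Ideal.add_mem _ (Ideal.add_mem _ (Ideal.add_mem _ (Ideal.add_mem _ (Ideal.add_mem _ ?_ ?_) ?_) ?_) ?_) ?_
  · rw [show (X 0 : MvPolynomial (Fin 5) k) * X 4 ^ 4 = X 4 ^ 2 * (X 0 * X 4 ^ 2) by ring]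
    exact Ideal.mul_mem_right _ _ (hsq 4)
  · rw [show (X 0 : MvPolynomial (Fin 5) k) ^ 3 * X 4 = X 0 ^ 2 * (X 0 * X 4) by ring]
    exact Ideal.mul_mem_right _ _ (hsq 0)
  · rw [show (X 0 : MvPolynomial (Fin 5) k) ^ 3 = X 0 ^ 2 * X 0 by ring]
    exact Ideal.mul_mem_right _ _ (hsq 0)
  · rw [show (X 1 : MvPolynomial (Fin 5) k) ^ 3 = X 1 ^ 2 * X 1 by ring]
    exact Ideal.mul_mem_right _ _ (hsq 1)
  · rw [show (X 2 : MvPolynomial (Fin 5) k) ^ 3 = X 2 ^ 2 * X 2 by ring]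
    exact Ideal.mul_mem_right _ _ (hsq 2)
  · rw [show (X 0 : MvPolynomial (Fin 5) k) ^ 4 * X 3 ^ 7 = X 0 ^ 2 * (X 0 ^ 2 * X 3 ^ 7) by ring]
    exact Ideal.mul_mem_right _ _ (hsq 0)

/-! ## §2 For EVERY blowing up along the point floor: legal ∧ not FULL -/

/-- ★★ **THE POINT FLOOR OF P3d4z4557 IS A LEGAL INPUT** of `TowerTerminates` / the F-half: for every blowing up `g : S′ → Spec 𝒪_{X,v}` along `I = 𝔪̃|_{Spec 𝒪_{X,v}}`:
(1) `I ≠ ⊥`; (2) `Supp I ⊆ (Reg Spec 𝒪_{X,v})ᶜ`; (3) `S′` is regular off the closed fibre; (4) `S′` satisfies the CM clause at every point — ONE application of the generic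
`PointFloorLegalOfIsolated.pointFloor_input_legal`. [folklore assembly; cite: GortzWedhorn2020, Prop. 13.91 (2)] [cite: StacksProject, Tag 02OS; Tag 01J7] [cite: Temkin2008, §2.1] -/
theorem pointFloor_fD_input_legal [CharP k 2] (f : MvPolynomial (Fin 5) k) (hf : f = X 4 ^ 4 + X 0 ^ 5 * X 4 + X 0 ^ 6 + X 1 ^ 3 + X 2 ^ 3 + X 3 ^ 7)
    (v : Spec (.of (MvPolynomial (Fin 5) k ⧸ Ideal.span {f})))
    (hv : v.asIdeal = Ideal.span (Set.range (fun j : Fin 5 => Ideal.Quotient.mk (Ideal.span {f}) (X j))))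
    (S' : Scheme.{0}) (g : S' ⟶ Spec ((Spec (.of (MvPolynomial (Fin 5) k ⧸ Ideal.span {f}))).presheaf.stalk v))
    (hg : IsBlowup g ((affineBlowup.idealSheaf (Ideal.span (Set.range (fun j : Fin 5 => Ideal.Quotient.mk (Ideal.span {f}) (X j))))).comap ((Spec (.of (MvPolynomial (Fin 5) k ⧸ Ideal.span {f}))).fromSpecStalk v))) :
    ((affineBlowup.idealSheaf (Ideal.span (Set.range (fun j : Fin 5 => Ideal.Quotient.mk (Ideal.span {f}) (X j))))).comap ((Spec (.of (MvPolynomial (Fin 5) k ⧸ Ideal.span {f}))).fromSpecStalk v)) ≠ ⊥ ∧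
    (((((affineBlowup.idealSheaf (Ideal.span (Set.range (fun j : Fin 5 => Ideal.Quotient.mk (Ideal.span {f}) (X j))))).comap ((Spec (.of (MvPolynomial (Fin 5) k ⧸ Ideal.span {f}))).fromSpecStalk v))).support : Set (Spec ((Spec (.of (MvPolynomial (Fin 5) k ⧸ Ideal.span {f}))).presheaf.stalk v))) ⊆ (Scheme.regularLocus (Spec ((Spec (.of (MvPolynomial (Fin 5) k ⧸ Ideal.span {f}))).presheaf.stalk v)))ᶜ) ∧
    (∀ s : S', g.base s ≠ closedPoint ((Spec (.of (MvPolynomial (Fin 5) k ⧸ Ideal.span {f}))).presheaf.stalk v) → s ∈ Scheme.regularLocus S') ∧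
    (∀ s : S', CMCl (S'.presheaf.stalk s)) :=
  PointFloorLegalOfIsolated.pointFloor_input_legal k f (FDSpecimen.prime_f k f hf) (by norm_num) (fun _ : Fin 5 => 3) _ (theta k f hf)
    (FDSpecimen.f_not_mem_span_X k f hf) (g_not_mem_span_X k) v hv (FDSpecimen.vertex_not_mem_regularLocus k f hf v hv)
    (FDSpecimen.regular_of_ne_vertex k f hf v hv) S' g hg

/-- ★★ **THE POINT FLOOR OF P3d4z4557 IS NOT FULL**: for every blowing up `g : S′ → Spec 𝒪_{X,v}` along `I` there is a point `s ∈ S′` over the closed point whose local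
ring is NOT `FullCl 2` (the origin of the chart `D(ȳ)`, Fedder certificate `g_zero_mem_bracket`) — ONE application of the generic `PointFloorNotFullOfFedder.pointFloor_not_full`.
[OURS · assembly; cite: Fedder1983, Prop. 1.7; GortzWedhorn2020, Prop. 13.91 (2)] -/
theorem pointFloor_fD_not_full [CharP k 2] (f : MvPolynomial (Fin 5) k) (hf : f = X 4 ^ 4 + X 0 ^ 5 * X 4 + X 0 ^ 6 + X 1 ^ 3 + X 2 ^ 3 + X 3 ^ 7)
    (v : Spec (.of (MvPolynomial (Fin 5) k ⧸ Ideal.span {f})))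
    (hv : v.asIdeal = Ideal.span (Set.range (fun j : Fin 5 => Ideal.Quotient.mk (Ideal.span {f}) (X j))))
    (S' : Scheme.{0}) (g : S' ⟶ Spec ((Spec (.of (MvPolynomial (Fin 5) k ⧸ Ideal.span {f}))).presheaf.stalk v))
    (hg : IsBlowup g ((affineBlowup.idealSheaf (Ideal.span (Set.range (fun j : Fin 5 => Ideal.Quotient.mk (Ideal.span {f}) (X j))))).comap ((Spec (.of (MvPolynomial (Fin 5) k ⧸ Ideal.span {f}))).fromSpecStalk v))) :
    ∃ s : S', g.base s = closedPoint ((Spec (.of (MvPolynomial (Fin 5) k ⧸ Ideal.span {f}))).presheaf.stalk v) ∧ ¬ FullCl 2 (S'.presheaf.stalk s) := by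
  haveI : Fact (Nat.Prime 2) := ⟨Nat.prime_two⟩
  exact PointFloorNotFullOfFedder.pointFloor_not_full 2 k f (FDSpecimen.prime_f k f hf) (fun _ : Fin 5 => 3) _ (theta k f hf)
    (FDSpecimen.f_not_mem_span_X k f hf) (g_not_mem_span_X k) (FDSpecimen.constantCoeff_f k f hf) 0 (constantCoeff_g_zero k)
    (g_zero_mem_bracket k) v hv S' g hg

/-- Hence no recipe tower of height `0` from this floor: `¬ RecipeTowerFull c 2 0 S′`, for EVERY centre recipe `c`. [OURS] -/
theorem not_recipeTowerFull_zero [CharP k 2] (c : IntrinsicTower.Recipes.CentreRecipe) (f : MvPolynomial (Fin 5) k) (hf : f = X 4 ^ 4 + X 0 ^ 5 * X 4 + X 0 ^ 6 + X 1 ^ 3 + X 2 ^ 3 + X 3 ^ 7)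
    (v : Spec (.of (MvPolynomial (Fin 5) k ⧸ Ideal.span {f})))
    (hv : v.asIdeal = Ideal.span (Set.range (fun j : Fin 5 => Ideal.Quotient.mk (Ideal.span {f}) (X j))))
    (S' : Scheme.{0}) (g : S' ⟶ Spec ((Spec (.of (MvPolynomial (Fin 5) k ⧸ Ideal.span {f}))).presheaf.stalk v))
    (hg : IsBlowup g ((affineBlowup.idealSheaf (Ideal.span (Set.range (fun j : Fin 5 => Ideal.Quotient.mk (Ideal.span {f}) (X j))))).comap ((Spec (.of (MvPolynomial (Fin 5) k ⧸ Ideal.span {f}))).fromSpecStalk v))) :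
    ¬ IntrinsicTower.Recipes.RecipeTowerFull c 2 0 S' := by
  intro h0
  obtain ⟨s, -, hs⟩ := pointFloor_fD_not_full k f hf v hv S' g hg
  exact hs (IntrinsicTower.Recipes.recipeTowerFull_zero.mp h0 s)

/-! ## §3 The binders of `TowerTerminates` and of the F-half are met at this floor, BY NAME, at `(d, p) = (4, 2)` -/

/-- ★ **`TowerTerminates c`, instantiated at the point floor of P3d4z4557** (the candidate taken as a hypothesis; all its binders discharged at `(d,p) = (4,2)`): the
`c`-tower from `S′` terminates at some height `n` (`≥ 1` by §2). [OURS · instantiation of a candidate statement] -/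
theorem recipeTowerFull_of_towerTerminates [CharP k 2] (c : IntrinsicTower.Recipes.CentreRecipe) (hTT : IntrinsicTower.Recipes.TowerTerminates c)
    (f : MvPolynomial (Fin 5) k) (hf : f = X 4 ^ 4 + X 0 ^ 5 * X 4 + X 0 ^ 6 + X 1 ^ 3 + X 2 ^ 3 + X 3 ^ 7)
    (v : Spec (.of (MvPolynomial (Fin 5) k ⧸ Ideal.span {f})))
    (hv : v.asIdeal = Ideal.span (Set.range (fun j : Fin 5 => Ideal.Quotient.mk (Ideal.span {f}) (X j))))
    (S' : Scheme.{0}) (g : S' ⟶ Spec ((Spec (.of (MvPolynomial (Fin 5) k ⧸ Ideal.span {f}))).presheaf.stalk v))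
    (hg : IsBlowup g ((affineBlowup.idealSheaf (Ideal.span (Set.range (fun j : Fin 5 => Ideal.Quotient.mk (Ideal.span {f}) (X j))))).comap ((Spec (.of (MvPolynomial (Fin 5) k ⧸ Ideal.span {f}))).fromSpecStalk v))) :
    ∃ n : ℕ, IntrinsicTower.Recipes.RecipeTowerFull c 2 n S' := by
  haveI := FDSpecimen.isIntegral_fD k f hf
  obtain ⟨h1, h2, h3, h4⟩ := pointFloor_fD_input_legal k f hf v hv S' g hg
  exact hTT 4 le_rfl 2 Nat.prime_two k (Spec (.of (MvPolynomial (Fin 5) k ⧸ Ideal.span {f})))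
    (Spec.map (CommRingCat.ofHom (algebraMap k (MvPolynomial (Fin 5) k ⧸ Ideal.span {f}))))
    (FermatCubicConeGerm.structureMorphism_isSeparated k f) (FermatCubicConeGerm.structureMorphism_locallyOfFiniteType k f)
    (FermatCubicConeGerm.structureMorphism_quasiCompact k f) inferInstance v (FDSpecimen.isClosed_vertex k f hf v hv)
    (FDSpecimen.vertex_not_mem_regularLocus k f hf v hv) (FDSpecimen.ringKrullDim_stalk_vertex k f hf v hv) S' g _ h1 h2 hg h3 h4

/-- ★ **The candidate F-half `LocalFInjectivizationFibreAdmGe4` (taken as a hypothesis), instantiated at the point floor of P3d4z4557, `(d, p) = (4, 2)`.**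
Discharging its conclusion here UNCONDITIONALLY (an `𝔪·K` certificate) would make this the first two-sided characteristic-3 row. [OURS · instantiation of a candidate statement] -/
theorem fHalf_at_pointFloor [CharP k 2] (h : LocalFullificationFibreAdmGe4Split.LocalFInjectivizationFibreAdmGe4) (f : MvPolynomial (Fin 5) k)
    (hf : f = X 4 ^ 4 + X 0 ^ 5 * X 4 + X 0 ^ 6 + X 1 ^ 3 + X 2 ^ 3 + X 3 ^ 7)
    (v : Spec (.of (MvPolynomial (Fin 5) k ⧸ Ideal.span {f})))
    (hv : v.asIdeal = Ideal.span (Set.range (fun j : Fin 5 => Ideal.Quotient.mk (Ideal.span {f}) (X j))))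
    (S' : Scheme.{0}) (g : S' ⟶ Spec ((Spec (.of (MvPolynomial (Fin 5) k ⧸ Ideal.span {f}))).presheaf.stalk v))
    (hg : IsBlowup g ((affineBlowup.idealSheaf (Ideal.span (Set.range (fun j : Fin 5 => Ideal.Quotient.mk (Ideal.span {f}) (X j))))).comap ((Spec (.of (MvPolynomial (Fin 5) k ⧸ Ideal.span {f}))).fromSpecStalk v))) :
    ∃ 𝓚 : S'.IdealSheafData, 𝓚 ≠ ⊥ ∧
      (∀ s ∈ (𝓚.support : Set S'), g.base s = closedPoint ((Spec (.of (MvPolynomial (Fin 5) k ⧸ Ideal.span {f}))).presheaf.stalk v)) ∧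
      ∀ (S'' : Scheme.{0}) (π : S'' ⟶ S'), IsBlowup π 𝓚 → ∀ s : S'', FullCl 2 (S''.presheaf.stalk s) := by
  haveI := FDSpecimen.isIntegral_fD k f hf
  obtain ⟨h1, h2, h3, h4⟩ := pointFloor_fD_input_legal k f hf v hv S' g hg
  exact h 4 le_rfl 2 Nat.prime_two k (Spec (.of (MvPolynomial (Fin 5) k ⧸ Ideal.span {f})))
    (Spec.map (CommRingCat.ofHom (algebraMap k (MvPolynomial (Fin 5) k ⧸ Ideal.span {f}))))
    (FermatCubicConeGerm.structureMorphism_isSeparated k f) (FermatCubicConeGerm.structureMorphism_locallyOfFiniteType k f)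
    (FermatCubicConeGerm.structureMorphism_quasiCompact k f) inferInstance v (FDSpecimen.isClosed_vertex k f hf v hv)
    (FDSpecimen.vertex_not_mem_regularLocus k f hf v hv) (FDSpecimen.ringKrullDim_stalk_vertex k f hf v hv) S' g _ h1 h2 hg h3 h4

end Summit.ResolutionOfSingularities.ResolutionOfSingularities.Theorems.FInjectiveMacaulayfication.FDPointFloor

end
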